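/-
COR-CM (cell pub-hodgecm2, stage 2 of the Hodge ladder) — count-neutral KERNEL CENSUS TRANSPORT, degree 10, cyclic type (seat
prover-pub-hodgecm2-b23-g32-0, binder prover b23, gen 32; claim INT2-TRANSPORT, HOME/lit/LIT-STATUS.md 2026-08-21T15:20:31Z;
sequel of `CorCM/FaceCensusOrbitTransport.lean`). Theorems only: four closed `Bool` side checks decided in the kernel (`decide
+kernel`, bundled in ONE type-specific statement `sideChecks`) against seat b30's orbit-equivariant census data
(`Census/DecicFaceSquaresCyclic.lean`: `Γ`, `genReps`, `certs` — used BY NAME, nothing restated or re-filed) and the resulting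
field-closure theorems. No definition, no named fact, nothing asserted; `Interfaces.lean` (C1), every E term, B01 and
`Transposition/*` are untouched. HONEST FRAMING (COORDINATOR RULING — HODGE FRAMING CORRECTION, 2026-08-21T11:55:35Z): `HC_CM` is
NOT proved, here or anywhere in the tree. Every closing theorem below is CONDITIONAL on face-period witnesses (for ONE field, on
the listed faces); no period is proved here.
T5 (coordinator ruling 15:33:56Z (3), lead staging l.4095): the census binders of the transport are DISCHARGED here by `decide`
(`sideChecks`); the dictionary binders (`e`, `hmul`, `hconj` / `ε`, `hε`, `c`) say «Gal(K/ℚ) ≅ this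
type with complex conjugation ↦ `Γ.conj`» and are inhabited by every Galois CM field of this type (examples in the docstring of
b30's census file); the face-reading binders are INHABITED IN THE KERNEL for every such enumeration (`exists_faces_octic*` below,
from `FaceCensus.exists_face_reads`); the only remaining hypotheses are the period witnesses / Weil-line algebraicity on the listed
faces = instances of the crux (`FacePeriodExists` / B01-S), against which the tree has no `¬` theorem on the universe of record —
no contradiction derivable; checker: self (prover-pub-hodgecm2-b23-g32-0), 2026-08-21T16:20Z.
-/
import Summits.HodgeConjecture.CorCM.FaceCensusOrbitTransport
import Summits.HodgeConjecture.CorCM.Census.DecicFaceSquaresCyclic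
import HarnessLib

/-!
# Degree 10, cyclic type `ℤ/10`: THREE face periods per cyclic decic Galois CM field close its slice (census transport)

Census transport instance (`FaceCensus.hgen_of_certOK_cover`, `CorCM/FaceCensusOrbitTransport.lean`) for the cyclic Galois CM
closure type `(ℤ/10, c = 5)` — the only Galois type of order 10 with a central involution — certified by seat b30 in
`Census/DecicFaceSquaresCyclic.lean` (THREE generating orbits of eight; representative codes `(31, 33, 66)`, `(31, 33, 132)`,
`(31, 66, 264)` = type `{0,1,2,3,4}`, places `{0,5}` with `{1,6}` / `{2,7}`, and `{1,6}` with `{3,8}`). The four side checks of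
the orbit-equivariant transport on b30's data by `decide +kernel` (`sideChecks`: orbit cells, pair labels, certified faces,
cover); the generation binder `hgen(𝒮, σ₀)` of INT2-GEN for every set `𝒮` of faces of a Galois CM field `K` of this type
containing faces that READ AS b30's generating representatives under an enumeration `e : GalT K ≃ Fin 10` of the table; non-
vacuity of those readings; and the CLOSED field-closure theorems on the universe of record — period witnesses on those `3` faces ⟹
the Hodge conjecture, in every codimension, for every complex abelian variety dominated by a finite product of abelian varieties
realising CM types of CM fields embeddable in `K` — in the `GalT` form and in the AUTOMORPHISM form (`ε : Aut(K) ≃ Fin 10`; bridge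
`FaceCensus.exists_enum_of_autEnum`). `HC_CM` is NOT proved and nothing here produces a period.

References: [cite: Pohlmann1968, Thm. 1]; [cite: Milne1999LefschetzClasses, Thm. 3.2 and Cor. 4.5];
[cite: Shimura1998, §6.2 Theorem 3 and §6.1 Corollary of Theorem 2 (pp. 41–43)]; [cite: MumfordAV1970, §19 Thm. 1 and p. 169].
-/

noncomputable section

open CategoryTheory NumberField NumberField.ComplexEmbedding
open Literature.AlgebraicGeometry Literature.AlgebraicGeometry.Motives Literature.AlgebraicGeometry.HodgeTheory
open Literature.AlgebraicGeometry.ComplexMultiplication Literature.AlgebraicGeometry.Milne1999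
open Literature.NumberTheory.Automorphic
open Literature.NumberTheory.Automorphic.PicardCM
open Summit.HodgeConjecture.CorCM.Domination

namespace Summit.HodgeConjecture.CorCM.DecicFaceTransport.Cyclic

open Summit.HodgeConjecture.CorCM.Census.FaceSquaresModel (mem flipAt)
open Summit.HodgeConjecture.CorCM.Census.DecicFaceSquaresCyclic (Γ genReps certs)

set_option maxRecDepth 16384 in
set_option maxHeartbeats 4000000 in -- four closed kernel evaluations over b30's certificate data of this type
/-- **The four side checks of the orbit-equivariant transport, type `ℤ/10` (cyclic decic; `c = 5`)** (bundled with the representative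
list so that the statement is type-specific): (1) ORBIT CELLS — every generator face of b30's certificates is one of the eight
faces of an explicit orbit cell of a generating representative; (2) PAIR LABELS — every divisor-pair label is a CM type of the
model; (3) CERTIFIED FACES — every certified face is a face of the model satisfying `certOK` over the generating representatives;
(4) COVER — the corner set of every face of the model is, in normal form, the corner set of a Galois twist of a certified face.
[folklore] -/
theorem sideChecks : genReps = [(31, 33, 66), (31, 33, 132), (31, 66, 264)] ∧
    (certs.all fun c => c.2.1.all fun gi => genReps.any fun r => (List.finRange 10).any fun j =>
    [(Γ.twist j r.1, Γ.twist j r.2.1, Γ.twist j r.2.2),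
      (flipAt (Γ.twist j r.2.1) (Γ.twist j r.1), Γ.twist j r.2.1, Γ.twist j r.2.2),
      (flipAt (Γ.twist j r.2.2) (Γ.twist j r.1), Γ.twist j r.2.1, Γ.twist j r.2.2),
      (flipAt (Γ.twist j r.2.2) (flipAt (Γ.twist j r.2.1) (Γ.twist j r.1)), Γ.twist j r.2.1, Γ.twist j r.2.2),
      (Γ.twist j r.1, Γ.twist j r.2.2, Γ.twist j r.2.1),
      (flipAt (Γ.twist j r.2.1) (Γ.twist j r.1), Γ.twist j r.2.2, Γ.twist j r.2.1),
      (flipAt (Γ.twist j r.2.2) (Γ.twist j r.1), Γ.twist j r.2.2, Γ.twist j r.2.1),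
      (flipAt (Γ.twist j r.2.2) (flipAt (Γ.twist j r.2.1) (Γ.twist j r.1)), Γ.twist j r.2.2, Γ.twist j r.2.1)].contains gi.1)
      = true ∧
    (certs.all fun c => c.2.2.all fun pj => Γ.isCMType pj.1) = true ∧
    (certs.all fun c => Γ.faces.contains c.1 && Γ.certOK genReps c.1 c.2.1 c.2.2) = true ∧
    (Γ.faces.all fun φ => certs.any fun c => (List.finRange 10).any fun j =>
      Census.FaceSquaresModel.normalize (Γ.corners φ) ==
        Census.FaceSquaresModel.normalize (Γ.corners (Γ.twist j c.1.1, Γ.twist j c.1.2.1, Γ.twist j c.1.2.2))) = true := by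
  refine ⟨rfl, ?_, ?_, ?_, ?_⟩ <;> decide +kernel

/-- **The generation binder, type `ℤ/10` (cyclic decic; `c = 5`).** `K` a Galois CM field with an enumeration `e : GalT K ≃ Fin 10` of
its Galois translates, multiplicative for b30's table and with `e conjT = 5`; `σ₀` a base embedding; `𝒮` any set of faces of `K`
containing faces READING AS the 3 generating representative codes `(31, 33, 66)` (type `{0,1,2,3,4}`, places `{0,5}`, `{1,6}`),
`(31, 33, 132)` (type `{0,1,2,3,4}`, places `{0,5}`, `{2,7}`), `(31, 66, 264)` (type `{0,1,2,3,4}`, places `{1,6}`, `{3,8}`) — `σ₀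
∘ P ∈ R.Φ ↔ e P ∈` the type, `R.p`, `R.p′` at the two places. Then `hgen(𝒮, σ₀)` holds at every face (b30's orbit-equivariant
certificates: three orbits of the eight generate). [cite: Pohlmann1968, Thm. 1] [cite: Milne1999LefschetzClasses, Thm. 3.2] -/
theorem hgen_decicCyclic (K : CMField) [IsGalois ℚ K] (e : GalT K ≃ Fin 10)
    (hmul : ∀ P Q : GalT K, e (P * Q) = Γ.mul (e P) (e Q)) (hconj : e conjT = Γ.conj) (σ₀ : (K : Type) →+* ℂ)
    (𝒮 : Set (Face K))
    (h₁ : ∃ R ∈ 𝒮, (∀ P : GalT K, P.1 σ₀ ∈ R.Φ.1 ↔ mem (e P) 31 = true) ∧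
      Γ.placeMask (e (translate σ₀ R.p)) = 33 ∧ Γ.placeMask (e (translate σ₀ R.p')) = 66)
    (h₂ : ∃ R ∈ 𝒮, (∀ P : GalT K, P.1 σ₀ ∈ R.Φ.1 ↔ mem (e P) 31 = true) ∧
      Γ.placeMask (e (translate σ₀ R.p)) = 33 ∧ Γ.placeMask (e (translate σ₀ R.p')) = 132)
    (h₃ : ∃ R ∈ 𝒮, (∀ P : GalT K, P.1 σ₀ ∈ R.Φ.1 ↔ mem (e P) 31 = true) ∧
      Γ.placeMask (e (translate σ₀ R.p)) = 66 ∧ Γ.placeMask (e (translate σ₀ R.p')) = 264) (f : Face K) :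
    lefChar f.corner (fun _ => ({σ₀} : Finset ((K : Type) →+* ℂ))) ∈ AddSubgroup.closure
      {a : Asym K | ∃ g ∈ 𝒮, ∃ σ : (K : Type) →+* ℂ, a = lefChar g.corner (fun _ => ({σ} : Finset ((K : Type) →+* ℂ)))} := by
  refine FaceCensus.hgen_of_certOK_cover Γ e hmul hconj genReps certs sideChecks.2.2.2.1 sideChecks.2.2.2.2 sideChecks.2.1
    sideChecks.2.2.1 σ₀ 𝒮 ?_ f
  intro r hr
  have hr' : r = (31, 33, 66) ∨ r = (31, 33, 132) ∨ r = (31, 66, 264) := by simpa [genReps] using hr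
  rcases hr' with rfl | rfl | rfl
  · obtain ⟨R, hRS, hΦ, hp, hq⟩ := h₁
    exact ⟨R, hRS, ⟨by decide, fun i => by rw [mem_pullType, hΦ, e.apply_symm_apply]⟩, hp, hq⟩
  · obtain ⟨R, hRS, hΦ, hp, hq⟩ := h₂
    exact ⟨R, hRS, ⟨by decide, fun i => by rw [mem_pullType, hΦ, e.apply_symm_apply]⟩, hp, hq⟩
  · obtain ⟨R, hRS, hΦ, hp, hq⟩ := h₃
    exact ⟨R, hRS, ⟨by decide, fun i => by rw [mem_pullType, hΦ, e.apply_symm_apply]⟩, hp, hq⟩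

set_option maxRecDepth 16384 in
/-- **Non-vacuity, type `ℤ/10` (cyclic decic; `c = 5`):** under any such enumeration, faces of `K` reading as the generating
representative codes EXIST (`FaceCensus.exists_face_reads`; the codes lie in `Γ.faces` by `decide`). [folklore] -/
theorem exists_faces_decicCyclic (K : CMField) [IsGalois ℚ K] (e : GalT K ≃ Fin 10)
    (hmul : ∀ P Q : GalT K, e (P * Q) = Γ.mul (e P) (e Q)) (hconj : e conjT = Γ.conj) (σ₀ : (K : Type) →+* ℂ) :
    ∃ R₁ R₂ R₃ : Face K,
      ((∀ P : GalT K, P.1 σ₀ ∈ R₁.Φ.1 ↔ mem (e P) 31 = true) ∧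
      Γ.placeMask (e (translate σ₀ R₁.p)) = 33 ∧ Γ.placeMask (e (translate σ₀ R₁.p')) = 66) ∧
      ((∀ P : GalT K, P.1 σ₀ ∈ R₂.Φ.1 ↔ mem (e P) 31 = true) ∧
      Γ.placeMask (e (translate σ₀ R₂.p)) = 33 ∧ Γ.placeMask (e (translate σ₀ R₂.p')) = 132) ∧
      ((∀ P : GalT K, P.1 σ₀ ∈ R₃.Φ.1 ↔ mem (e P) 31 = true) ∧
      Γ.placeMask (e (translate σ₀ R₃.p)) = 66 ∧ Γ.placeMask (e (translate σ₀ R₃.p')) = 264) := by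
  obtain ⟨R₁, hT₁, hp₁, hq₁⟩ := FaceCensus.exists_face_reads Γ e hmul hconj σ₀ (r := (31, 33, 66))
    (by decide +kernel)
  obtain ⟨R₂, hT₂, hp₂, hq₂⟩ := FaceCensus.exists_face_reads Γ e hmul hconj σ₀ (r := (31, 33, 132))
    (by decide +kernel)
  obtain ⟨R₃, hT₃, hp₃, hq₃⟩ := FaceCensus.exists_face_reads Γ e hmul hconj σ₀ (r := (31, 66, 264))
    (by decide +kernel)
  exact ⟨R₁, R₂, R₃, ⟨fun P => by rw [← mem_pullType, ← e.symm_apply_apply P, ← hT₁.2 (e P), e.symm_apply_apply],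
    hp₁, hq₁⟩, ⟨fun P => by rw [← mem_pullType, ← e.symm_apply_apply P, ← hT₂.2 (e P), e.symm_apply_apply],
    hp₂, hq₂⟩, ⟨fun P => by rw [← mem_pullType, ← e.symm_apply_apply P, ← hT₃.2 (e P), e.symm_apply_apply],
    hp₃, hq₃⟩⟩

/-- **FIELD CLOSURE, type `ℤ/10` (cyclic decic; `c = 5`) — period-witness form, CLOSED (headline).** `K`, `e`, `σ₀` as above and 3
faces of `K` reading as the generating representatives; ONE period witness for each on the universe of record (some admissible
`ι₁`, some hermitian 3-space, some level, eigenforms at some `σ`) implies the Hodge conjecture, in every codimension, for every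
complex abelian variety dominated by a finite product of abelian varieties realising CM types of CM fields embeddable in `K`.
(FRAMING: conditional on these 3 face periods; `HC_CM` is not proved.) [cite: Shimura1998, §6.2 Theorem 3 and §6.1 Corollary of
Theorem 2 (pp. 41–43)] [cite: Pohlmann1968, Thm. 1] [cite: Milne1999LefschetzClasses, Thm. 3.2 and Cor. 4.5] [cite: MumfordAV1970,
§19 Thm. 1 and p. 169] -/
theorem hodgeConjectureFor_of_avDominatedBy_isProductOf_of_facePeriod_decicCyclic (K : CMField) [IsGalois ℚ K]
    (e : GalT K ≃ Fin 10) (hmul : ∀ P Q : GalT K, e (P * Q) = Γ.mul (e P) (e Q)) (hconj : e conjT = Γ.conj)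
    (σ₀ : (K : Type) →+* ℂ) (R₁ R₂ R₃ : Face K)
    (hR₁ : (∀ P : GalT K, P.1 σ₀ ∈ R₁.Φ.1 ↔ mem (e P) 31 = true) ∧
      Γ.placeMask (e (translate σ₀ R₁.p)) = 33 ∧ Γ.placeMask (e (translate σ₀ R₁.p')) = 66)
    (hR₂ : (∀ P : GalT K, P.1 σ₀ ∈ R₂.Φ.1 ↔ mem (e P) 31 = true) ∧
      Γ.placeMask (e (translate σ₀ R₂.p)) = 33 ∧ Γ.placeMask (e (translate σ₀ R₂.p')) = 132)
    (hR₃ : (∀ P : GalT K, P.1 σ₀ ∈ R₃.Φ.1 ↔ mem (e P) 31 = true) ∧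
      Γ.placeMask (e (translate σ₀ R₃.p)) = 66 ∧ Γ.placeMask (e (translate σ₀ R₃.p')) = 264)
    (h₁ : ∃ ι₁ : K →+* ℂ, R₁.Admissible ι₁ ∧ ∃ (V : HermSpace3 K ι₁) (σ : K →+* ℂ),
      (Model.picardCMUniverse exists_isReal_hodgeModel_holds hodgePQ_independent_of_hodgeModel_holds
        BallQuotient.ballQuotientUniformised_holds cmAbelianVarietyRealised_holds).PeriodNV ι₁ V K R₁.psi σ)
    (h₂ : ∃ ι₁ : K →+* ℂ, R₂.Admissible ι₁ ∧ ∃ (V : HermSpace3 K ι₁) (σ : K →+* ℂ),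
      (Model.picardCMUniverse exists_isReal_hodgeModel_holds hodgePQ_independent_of_hodgeModel_holds
        BallQuotient.ballQuotientUniformised_holds cmAbelianVarietyRealised_holds).PeriodNV ι₁ V K R₂.psi σ)
    (h₃ : ∃ ι₁ : K →+* ℂ, R₃.Admissible ι₁ ∧ ∃ (V : HermSpace3 K ι₁) (σ : K →+* ℂ),
      (Model.picardCMUniverse exists_isReal_hodgeModel_holds hodgePQ_independent_of_hodgeModel_holds
        BallQuotient.ballQuotientUniformised_holds cmAbelianVarietyRealised_holds).PeriodNV ι₁ V K R₃.psi σ)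
    {P A : AbelianVariety ℂ} (hP : AbelianVariety.IsProductOf (fun B : AbelianVariety ℂ =>
      ∃ (E : Type) (_ : Field E) (_ : NumberField E) (_ : IsCMField E) (_ : E →+* (K : Type)) (Φ : CMType E)
        (ι : 𝓞 E →+* End B) (θ : E →+* Module.End ℂ (complexBetti B.X 1)),
        IsCMTypeRealisation Φ B ι θ) P)
    (hA : AVDominatedBy A P) : HodgeConjectureFor A.dim A.X :=
  hodgeConjectureFor_of_avDominatedBy_isProductOf_of_exists_facePeriod_on K
    ((show 6 ≤ 10 by decide).trans_eq (FaceCensus.eq_finrank_of_enum e)) {R₁, R₂, R₃} σ₀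
    (hgen_decicCyclic K e hmul hconj σ₀ {R₁, R₂, R₃} ⟨R₁, by simp, hR₁⟩ ⟨R₂, by simp, hR₂⟩ ⟨R₃, by simp, hR₃⟩)
    (fun f hf => by
      simp only [Set.mem_insert_iff, Set.mem_singleton_iff] at hf
      rcases hf with rfl | rfl | rfl
      · exact h₁
      · exact h₂
      · exact h₃) hP hA


/-- **FIELD CLOSURE, type `ℤ/10` (cyclic decic; `c = 5`) — from AUTOMORPHISM data (the form a field-specific seat has).** Same
conclusion with the dictionary given on `Aut(K)`: a base embedding `σ₀`, a bijection `ε : Aut(K) ≃ Fin 10` multiplicative for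
b30's table, the automorphism `c` inducing complex conjugation at `σ₀` with `ε c = 5`, and the faces described through `ε` (`σ₀ ∘
g ∈ Rᵢ.Φ ↔ ε g ∈` type mask; place representatives `σ₀ ∘ g_p`, `σ₀ ∘ g_q` with the listed place masks). The enumeration of `GalT
K` is produced by `FaceCensus.exists_enum_of_autEnum` (`CorCM/FaceCensusCells.lean`). (FRAMING: conditional on the face periods;
`HC_CM` is not proved.) [cite: Shimura1998, §6.2 Theorem 3 and §6.1 Corollary of Theorem 2 (pp. 41–43)] [cite: Pohlmann1968, Thm.
1] [cite: Milne1999LefschetzClasses, Thm. 3.2 and Cor. 4.5] [cite: MumfordAV1970, §19 Thm. 1 and p. 169] -/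
theorem hodgeConjectureFor_of_avDominatedBy_isProductOf_of_facePeriod_decicCyclic_aut (K : CMField) [IsGalois ℚ K]
    (σ₀ : (K : Type) →+* ℂ) (ε : ((K : Type) ≃ₐ[ℚ] (K : Type)) ≃ Fin 10)
    (hε : ∀ g h : ((K : Type) ≃ₐ[ℚ] (K : Type)), ε (g * h) = Γ.mul (ε g) (ε h))
    (c : ((K : Type) ≃ₐ[ℚ] (K : Type))) (hc : σ₀.comp (c : (K : Type) →+* (K : Type)) = conjugate σ₀) (hεc : ε c = Γ.conj)
    (R₁ R₂ R₃ : Face K) (g₁ g₁' : ((K : Type) ≃ₐ[ℚ] (K : Type))) (g₂ g₂' : ((K : Type) ≃ₐ[ℚ] (K : Type))) (g₃ g₃' : ((K : Type) ≃ₐ[ℚ] (K : Type)))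
    (hΦ₁ : ∀ g : ((K : Type) ≃ₐ[ℚ] (K : Type)),
      σ₀.comp (g : (K : Type) →+* (K : Type)) ∈ R₁.Φ.1 ↔ mem (ε g) 31 = true)
    (hp₁ : R₁.p = σ₀.comp (g₁ : (K : Type) →+* (K : Type))) (hp₁' : Γ.placeMask (ε g₁) = 33)
    (hq₁ : R₁.p' = σ₀.comp (g₁' : (K : Type) →+* (K : Type))) (hq₁' : Γ.placeMask (ε g₁') = 66)
    (hΦ₂ : ∀ g : ((K : Type) ≃ₐ[ℚ] (K : Type)),
      σ₀.comp (g : (K : Type) →+* (K : Type)) ∈ R₂.Φ.1 ↔ mem (ε g) 31 = true)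
    (hp₂ : R₂.p = σ₀.comp (g₂ : (K : Type) →+* (K : Type))) (hp₂' : Γ.placeMask (ε g₂) = 33)
    (hq₂ : R₂.p' = σ₀.comp (g₂' : (K : Type) →+* (K : Type))) (hq₂' : Γ.placeMask (ε g₂') = 132)
    (hΦ₃ : ∀ g : ((K : Type) ≃ₐ[ℚ] (K : Type)),
      σ₀.comp (g : (K : Type) →+* (K : Type)) ∈ R₃.Φ.1 ↔ mem (ε g) 31 = true)
    (hp₃ : R₃.p = σ₀.comp (g₃ : (K : Type) →+* (K : Type))) (hp₃' : Γ.placeMask (ε g₃) = 66)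
    (hq₃ : R₃.p' = σ₀.comp (g₃' : (K : Type) →+* (K : Type))) (hq₃' : Γ.placeMask (ε g₃') = 264)
    (h₁ : ∃ ι₁ : K →+* ℂ, R₁.Admissible ι₁ ∧ ∃ (V : HermSpace3 K ι₁) (σ : K →+* ℂ),
      (Model.picardCMUniverse exists_isReal_hodgeModel_holds hodgePQ_independent_of_hodgeModel_holds
        BallQuotient.ballQuotientUniformised_holds cmAbelianVarietyRealised_holds).PeriodNV ι₁ V K R₁.psi σ)
    (h₂ : ∃ ι₁ : K →+* ℂ, R₂.Admissible ι₁ ∧ ∃ (V : HermSpace3 K ι₁) (σ : K →+* ℂ),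
      (Model.picardCMUniverse exists_isReal_hodgeModel_holds hodgePQ_independent_of_hodgeModel_holds
        BallQuotient.ballQuotientUniformised_holds cmAbelianVarietyRealised_holds).PeriodNV ι₁ V K R₂.psi σ)
    (h₃ : ∃ ι₁ : K →+* ℂ, R₃.Admissible ι₁ ∧ ∃ (V : HermSpace3 K ι₁) (σ : K →+* ℂ),
      (Model.picardCMUniverse exists_isReal_hodgeModel_holds hodgePQ_independent_of_hodgeModel_holds
        BallQuotient.ballQuotientUniformised_holds cmAbelianVarietyRealised_holds).PeriodNV ι₁ V K R₃.psi σ)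
    {P A : AbelianVariety ℂ} (hP : AbelianVariety.IsProductOf (fun B : AbelianVariety ℂ =>
      ∃ (E : Type) (_ : Field E) (_ : NumberField E) (_ : IsCMField E) (_ : E →+* (K : Type)) (Φ : CMType E)
        (ι : 𝓞 E →+* End B) (θ : E →+* Module.End ℂ (complexBetti B.X 1)),
        IsCMTypeRealisation Φ B ι θ) P)
    (hA : AVDominatedBy A P) : HodgeConjectureFor A.dim A.X := by
  obtain ⟨e, hmul, he⟩ := FaceCensus.exists_enum_of_autEnum Γ σ₀ ε hε
  have hconj : e conjT = Γ.conj := by rw [FaceCensus.conjT_eq_translate σ₀, ← hc, he, hεc]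
  exact hodgeConjectureFor_of_avDominatedBy_isProductOf_of_facePeriod_decicCyclic K e hmul hconj σ₀ R₁ R₂ R₃
    (FaceCensus.reads_of_autEnum Γ e σ₀ ε he R₁ hΦ₁ hp₁ hp₁' hq₁ hq₁')
    (FaceCensus.reads_of_autEnum Γ e σ₀ ε he R₂ hΦ₂ hp₂ hp₂' hq₂ hq₂')
    (FaceCensus.reads_of_autEnum Γ e σ₀ ε he R₃ hΦ₃ hp₃ hp₃' hq₃ hq₃')
    h₁ h₂ h₃ hP hA

end Summit.HodgeConjecture.CorCM.DecicFaceTransport.Cyclic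


end
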